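import Literature.NumberTheory.QuadraticFields.SplitPrimeKummerWitness
import Literature.NumberTheory.QuadraticFields.RingClassPrimeConductorOrder
import HarnessLib

/-!
# The Kummer witness of a split prime, II: the residue law `p^E ∣ orderOf [𝔭_v]_ℓ` and the assembled
# statement `SplitPrimeKummerWitness K p q` (Cox, *Primes of the form x² + ny²*, §7.D (7.27); Gross 1991, §3)

Topic `NumberTheory/QuadraticFields`, namespace `Literature.NumberTheory.QuadraticFields.RingClass`; sequel
of `SplitPrimeKummerWitness.lean` (the witness `γ = (σβ)^{p+1}β^{p-1}`, its norm, `γ ∉ K^{×p}`, residue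
translation, Euler's criterion) and of `RingClassPrimeConductorOrder.lean` (the prime-conductor order
lemma `pow_dvd_orderOf_primeClass_of_inert`, bsd-line-er5-p1-w2 g5). Theorems only — no definition,
no named fact (D-0026); unconditional.

* **`pow_dvd_orderOf_primeClass_of_kummerWitness`** — `K` imaginary quadratic with `d_K < -4`, `𝔮 ∋ q`
  a prime with `𝔮^h = (β)`, `ℓ ≠ q` a prime inert in `K`, `p ≥ 3` prime, `p^E ∣ ℓ + 1`, `E ≥ 1`: if
  `(σβ)^{p+1}β^{p-1}` is not a `p`-th power modulo `ℓ𝒪_K`, then `p^E ∣ orderOf [𝔭_v]_ℓ` for every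
  prime `v ∋ q` of `K` (for `v = 𝔮`: `β` is not a `p`-th power mod `ℓ`, so `β^{(ℓ²-1)/p} ≢ 1`, then
  Cox (7.27) at prime conductor; all `v ∣ q` are conjugate to `𝔮` and conjugate classes have equal
  order);
* **`exists_splitPrimeKummerWitness`** — for every exponent `E`: `γ ∈ 𝒪_K ∖ 0`, `r ∈ ℚ`, `T₀ = {q}`
  with `N(γ) = r^p`, `γ ∉ K^{×p}`, and the residue law above — VERBATIM the body of the statement
  `SplitPrimeKummerWitness K p q` of the auxiliary-norm line on Heegner points (crux
  `EulerHalfNotRamNoInertSetAtFive`, leaf stub (O)), which feeds the Chebotarev–Kummer prime supply in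
  `K(E[p^E], γ^{1/p})`.

## References

* D. A. Cox, *Primes of the form x² + ny²*, 2nd ed., Wiley (2013): §7.B, §7.C Prop. 7.22, §7.D (7.27),
  Thm. 7.24. [Cox2013]
* B. H. Gross, *Kolyvagin's work on modular elliptic curves*, LMS LNS 153 (1991), §3 (p. 239). [GrossLMS1991]
* D. A. Marcus, *Number Fields*, 2nd ed. (2018), Ch. 3, Thm. 25. [Marcus2018]

## Mathlib / tree search

Tree (by name): `RingClass.pow_dvd_orderOf_primeClass_of_inert` (`RingClassPrimeConductorOrder`),
`exists_pow_sub_mem_span_of_pow_div_sub_one_mem`, `exists_pow_sub_kummerWitness_mem`, `norm_kummerWitness`,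
`not_exists_pow_eq_kummerWitness` (`SplitPrimeKummerWitness`), `orderOf_primeClass_eq_of_smul`
(`EllipticCurves/RingClassFieldDecompositionGroup`), `eq_one_or_eq_of_card_eq_two` (`ConjugateIdealClass`),
`intCast_mem_span_iff`, `exists_basis_zero_eq_one`. Mathlib: `Ideal.exists_smul_eq_of_isGaloisGroup`,
`Ideal.IsMaximal.coprime_of_ne`, `ClassGroup.mk0_eq_one_iff`, `Set.nonempty_of_ncard_ne_zero`.
-/

noncomputable section

open scoped nonZeroDivisors NumberField Pointwise Classical
open Module NumberField IsDedekindDomain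

namespace Literature.NumberTheory.QuadraticFields.RingClass

open Literature.NumberTheory.NumberFields.RingClassField
open Literature.NumberTheory.QuadraticFields.Quadratic
open Literature.NumberTheory.EllipticCurves

variable {K : Type} [Field K] [NumberField K]

omit [NumberField K] in
/-- A prime of `𝓞_K` containing a rational prime `q` lies above `(q) ⊂ ℤ`. [folklore] -/
private theorem under_int_eq_span_of_natCast_mem'' {q : ℕ} (hq : q.Prime) {P : Ideal (𝓞 K)}
    [P.IsPrime] (hqP : (q : 𝓞 K) ∈ P) : P.under ℤ = Ideal.span {(q : ℤ)} := by
  have hmax : (Ideal.span {(q : ℤ)}).IsMaximal :=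
    PrincipalIdealRing.isMaximal_of_irreducible (Nat.prime_iff_prime_int.mp hq).irreducible
  refine (hmax.eq_of_le (Ideal.IsPrime.under ℤ P).ne_top ?_).symm
  rw [Ideal.span_singleton_le_iff_mem, Ideal.mem_comap, map_natCast]
  exact hqP

/-! ### §4. The residue law at an auxiliary inert prime, and the assembled witness -/

/-- **`p^E ∣ orderOf [𝔭_v]_ℓ` for every `v ∣ q` when the Kummer witness is not a `p`-th power mod `ℓ`.**
`K` imaginary quadratic, `d_K < -4`, `σ` an automorphism, `𝔮 ∋ q` a prime with `𝔮^h = (β)`, `ℓ ≠ q` a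
prime inert in `K`, `p ≥ 3` prime, `p^E ∣ ℓ + 1` with `E ≥ 1`: if `(σβ)^{p+1}β^{p-1}` is not a `p`-th
power modulo `ℓ𝒪_K`, then `p^E ∣ orderOf [𝔭_v]_ℓ` for every prime `v ∋ q` of `K` (for `v = 𝔮` by
`pow_dvd_orderOf_primeClass_of_inert`, Cox (7.27); all `v ∣ q` are conjugate to `𝔮` and conjugate
classes have equal order). [cite: Cox2013, §7.D (7.27), §7.B] [cite: GrossLMS1991, §3 (p. 239)] -/
theorem pow_dvd_orderOf_primeClass_of_kummerWitness (hK : IsImaginaryQuadratic K)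
    (hd : NumberField.discr K < -4) (τ : K ≃ₐ[ℚ] K) {q : ℕ} (hq : q.Prime)
    (𝔮 : HeightOneSpectrum (𝓞 K)) (hq𝔮 : (q : 𝓞 K) ∈ 𝔮.asIdeal) {h : ℕ} {β : 𝓞 K}
    (hβ : 𝔮.asIdeal ^ h = Ideal.span {β}) {ℓ : ℕ} (hℓ : ℓ.Prime) (hℓq : ℓ ≠ q)
    (hℓP : (Ideal.span {(ℓ : 𝓞 K)}).IsPrime) {p E : ℕ} (hp : p.Prime) (hp3 : 3 ≤ p) (hE : 1 ≤ E)
    (hpE : p ^ E ∣ ℓ + 1)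
    (hγ : ¬ ∃ y : 𝓞 K, y ^ p - (τ • β) ^ (p + 1) * β ^ (p - 1) ∈ Ideal.span {(ℓ : 𝓞 K)})
    (v : HeightOneSpectrum (𝓞 K)) (hqv : (q : 𝓞 K) ∈ v.asIdeal) :
    p ^ E ∣ orderOf (primeClass ℓ v) := by
  classical
  haveI : Algebra.IsQuadraticExtension ℚ K := ⟨hK.1⟩
  haveI : IsGaloisGroup (K ≃ₐ[ℚ] K) ℤ (𝓞 K) :=
    IsGaloisGroup.of_isFractionRing (K ≃ₐ[ℚ] K) ℤ (𝓞 K) ℚ K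
  obtain ⟨b, hb⟩ := exists_basis_zero_eq_one hK.1
  -- `p ∣ ℓ + 1`, `p ∤ ℓ - 1`, `p ∣ ℓ² - 1`
  have hpℓ1 : p ∣ ℓ + 1 := (dvd_pow_self p (by omega)).trans hpE
  have hpℓ : ¬ p ∣ ℓ - 1 := by
    intro hd'
    have h2' : p ∣ (ℓ + 1) - (ℓ - 1) := Nat.dvd_sub hpℓ1 hd'
    have hℓ2 := hℓ.two_le
    have : (ℓ + 1) - (ℓ - 1) = 2 := by omega
    rw [this] at h2'
    have := Nat.le_of_dvd two_pos h2'
    omega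
  have hpℓ2 : p ∣ ℓ ^ 2 - 1 := by
    have : ℓ ^ 2 - 1 = (ℓ + 1) * (ℓ - 1) := by
      have hℓ1 := hℓ.one_lt.le
      zify [hℓ1, Nat.one_le_pow 2 ℓ hℓ.pos]
      ring
    rw [this]
    exact hpℓ1.mul_right _
  -- `ℓ ∤ q`: `q ∉ ℓ𝓞_K`
  have hqℓ : (q : 𝓞 K) ∉ Ideal.span {(ℓ : 𝓞 K)} := by
    intro hmem
    have h1 : ((q : ℤ) : 𝓞 K) ∈ Ideal.span {(ℓ : 𝓞 K)} := by exact_mod_cast hmem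
    rw [intCast_mem_span_iff b hb] at h1
    have h2' : ℓ ∣ q := by exact_mod_cast h1
    exact hℓq ((Nat.prime_dvd_prime_iff_eq hℓ hq).mp h2')
  -- `β ∉ ℓ𝓞_K` and `𝔮 + ℓ𝓞_K = 𝓞_K`
  have hℓne : Ideal.span {(ℓ : 𝓞 K)} ≠ ⊥ := by
    rw [Ne, Ideal.span_singleton_eq_bot]; exact_mod_cast hℓ.ne_zero
  haveI hℓmax : (Ideal.span {(ℓ : 𝓞 K)}).IsMaximal := hℓP.isMaximal hℓne
  have h𝔮ℓ : 𝔮.asIdeal ≠ Ideal.span {(ℓ : 𝓞 K)} := fun h' => hqℓ (h' ▸ hq𝔮)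
  have hsup : 𝔮.asIdeal ⊔ Ideal.span {(ℓ : 𝓞 K)} = ⊤ := Ideal.IsMaximal.coprime_of_ne 𝔮.isMaximal hℓmax h𝔮ℓ
  have hβℓ : β ∉ Ideal.span {(ℓ : 𝓞 K)} := by
    intro hmem
    have hle : 𝔮.asIdeal ^ h ≤ Ideal.span {(ℓ : 𝓞 K)} := by
      rw [hβ, Ideal.span_singleton_le_iff_mem]; exact hmem
    haveI := hℓP
    exact h𝔮ℓ (𝔮.isMaximal.eq_of_le hℓP.ne_top (Ideal.IsPrime.le_of_pow_le hle))
  -- `β` is not a `p`-th power mod `ℓ`, hence `β^{(ℓ²-1)/p} ≢ 1`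
  have hβnp : ¬ ∃ u : 𝓞 K, u ^ p - β ∈ Ideal.span {(ℓ : 𝓞 K)} := by
    rintro ⟨u, hu⟩
    exact hγ (exists_pow_sub_kummerWitness_mem τ hu)
  have hkum : β ^ ((ℓ ^ 2 - 1) / p) - 1 ∉ Ideal.span {(ℓ : 𝓞 K)} := fun h1 =>
    hβnp (exists_pow_sub_mem_span_of_pow_div_sub_one_mem hK.1 hℓ hℓP hp hpℓ2 hβℓ h1)
  -- at `v = 𝔮`
  have h𝔮ord : p ^ E ∣ orderOf (primeClass ℓ 𝔮) :=
    pow_dvd_orderOf_primeClass_of_inert hK.1 hd hℓ hℓP hp hpE hpℓ hsup hβ hkum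
  -- every `v ∋ q` is conjugate to `𝔮`
  haveI := 𝔮.isPrime
  haveI := v.isPrime
  have hunder : 𝔮.asIdeal.under ℤ = v.asIdeal.under ℤ := by
    rw [under_int_eq_span_of_natCast_mem'' hq hq𝔮, under_int_eq_span_of_natCast_mem'' hq hqv]
  haveI : 𝔮.asIdeal.LiesOver (𝔮.asIdeal.under ℤ) := ⟨rfl⟩
  haveI : v.asIdeal.LiesOver (𝔮.asIdeal.under ℤ) := ⟨hunder⟩
  obtain ⟨σ, hσ⟩ := Ideal.exists_smul_eq_of_isGaloisGroup (𝔮.asIdeal.under ℤ) 𝔮.asIdeal v.asIdeal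
    (K ≃ₐ[ℚ] K)
  have hv : ¬ Ideal.span {(ℓ : 𝓞 K)} ≤ 𝔮.asIdeal :=
    (sup_span_eq_top_iff_not_le ℓ).mp hsup
  rw [orderOf_primeClass_eq_of_smul hK.1 σ ℓ hσ.symm hv]
  exact h𝔮ord

/-- **The Kummer witness of a split prime** (the statement `SplitPrimeKummerWitness K p q` of the
auxiliary-norm line, proved): for `K` imaginary quadratic with `d_K < -4`, a prime `p ≥ 3` and a
rational prime `q` split in `K` (two primes above it), for every exponent `E` there are
`γ ∈ 𝒪_K ∖ 0`, `r ∈ ℚ` and a finite bad set `T₀` (`= {q}`) with `N_{K/ℚ}(γ) = r^p`, `γ ∉ K^{×p}`, and: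
for every prime `ℓ₀ ∉ T₀` inert in `K` with `p^E ∣ ℓ₀ + 1` modulo which `γ` is not a `p`-th power,
`p^E ∣ orderOf [𝔭_v]_{ℓ₀}` for all primes `v ∋ q` of `K`. (Witness `γ = (σβ)^{p+1} β^{p-1}` with
`𝔮^h = (β)`, `h = orderOf [𝔮]`; Cox §7.B–§7.D.) [cite: Cox2013, §7.B, §7.C Prop. 7.22, §7.D (7.27), Thm. 7.24]
[cite: GrossLMS1991, §3 (p. 239)] [cite: Marcus2018, Ch. 3, Thm. 25] -/
theorem exists_splitPrimeKummerWitness (hK : IsImaginaryQuadratic K) (hd : NumberField.discr K < -4)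
    {p : ℕ} (hp : p.Prime) (hp3 : 3 ≤ p) {q : ℕ} (hq : q.Prime)
    (hq2 : ((Ideal.span {(q : ℤ)}).primesOver (𝓞 K)).ncard = 2) (E : ℕ) :
    ∃ (γ : 𝓞 K) (r : ℚ) (T₀ : Finset ℕ), γ ≠ 0 ∧ Algebra.norm ℚ (γ : K) = r ^ p ∧
      (∀ y : K, y ^ p ≠ (γ : K)) ∧
      ∀ ℓ₀ : ℕ, ℓ₀.Prime → ℓ₀ ∉ T₀ → (Ideal.span {(ℓ₀ : 𝓞 K)}).IsPrime → p ^ E ∣ ℓ₀ + 1 →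
        (¬ ∃ y : 𝓞 K, y ^ p - γ ∈ Ideal.span {(ℓ₀ : 𝓞 K)}) →
        ∀ v : HeightOneSpectrum (𝓞 K), ((q : ℕ) : 𝓞 K) ∈ v.asIdeal →
          p ^ E ∣ orderOf (primeClass ℓ₀ v) := by
  classical
  haveI : Algebra.IsQuadraticExtension ℚ K := ⟨hK.1⟩
  haveI : IsGaloisGroup (K ≃ₐ[ℚ] K) ℤ (𝓞 K) :=
    IsGaloisGroup.of_isFractionRing (K ≃ₐ[ℚ] K) ℤ (𝓞 K) ℚ K
  have hG : Nat.card (K ≃ₐ[ℚ] K) = 2 := by rw [IsGalois.card_aut_eq_finrank, hK.1]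
  -- the non-trivial automorphism
  obtain ⟨τ, hτ⟩ : ∃ τ : K ≃ₐ[ℚ] K, τ ≠ 1 := by
    by_contra hall
    push Not at hall
    haveI : Subsingleton (K ≃ₐ[ℚ] K) := ⟨fun a b => by rw [hall a, hall b]⟩
    have : Nat.card (K ≃ₐ[ℚ] K) = 1 := Nat.card_of_subsingleton 1
    omega
  -- a prime `𝔮 ∋ q` with `τ𝔮 ≠ 𝔮`
  set qZ : Ideal ℤ := Ideal.span {(q : ℤ)} with hqZ
  obtain ⟨Q, hQ⟩ : (qZ.primesOver (𝓞 K)).Nonempty :=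
    Set.nonempty_of_ncard_ne_zero (by rw [hq2]; norm_num)
  haveI := hQ.1
  haveI := hQ.2
  have hqZ0 : qZ ≠ ⊥ := by
    rw [hqZ, Ne, Ideal.span_singleton_eq_bot]; exact_mod_cast hq.ne_zero
  have hQ0 : Q ≠ ⊥ := Ideal.ne_bot_of_liesOver_of_ne_bot hqZ0 Q
  let 𝔮 : HeightOneSpectrum (𝓞 K) := ⟨Q, hQ.1, hQ0⟩
  have hq𝔮 : (q : 𝓞 K) ∈ 𝔮.asIdeal := by
    have h1 : algebraMap ℤ (𝓞 K) (q : ℤ) ∈ Q := by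
      rw [← Ideal.mem_comap, ← Ideal.under_def, ← Ideal.over_def Q qZ, hqZ]
      exact Ideal.mem_span_singleton_self _
    simpa using h1
  have hne : τ • 𝔮.asIdeal ≠ 𝔮.asIdeal := by
    intro hfix
    -- then every prime above `q` is `Q`, contradicting `ncard = 2`
    have hall : qZ.primesOver (𝓞 K) = {Q} := by
      ext Q'
      simp only [Set.mem_singleton_iff]
      constructor
      · intro hQ'
        haveI := hQ'.1
        haveI := hQ'.2
        obtain ⟨σ, rfl⟩ := Ideal.exists_smul_eq_of_isGaloisGroup qZ Q Q' (K ≃ₐ[ℚ] K)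
        rcases eq_one_or_eq_of_card_eq_two hG hτ σ with h1 | h1
        · rw [h1, one_smul]
        · rw [h1]; exact hfix
      · rintro rfl; exact hQ
    have : (qZ.primesOver (𝓞 K)).ncard = 1 := by rw [hall, Set.ncard_singleton]
    omega
  -- `h = orderOf [𝔮]`, `𝔮^h = (β)`
  set I : (Ideal (𝓞 K))⁰ := ⟨𝔮.asIdeal, mem_nonZeroDivisors_iff_ne_zero.mpr 𝔮.ne_bot⟩ with hI
  set h := orderOf (ClassGroup.mk0 I) with hh
  have h1 : ClassGroup.mk0 (I ^ h) = 1 := by rw [map_pow, hh, pow_orderOf_eq_one]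
  have hprinc : (𝔮.asIdeal ^ h).IsPrincipal := by
    have h' := (ClassGroup.mk0_eq_one_iff (I ^ h).2).mp h1
    rwa [SubmonoidClass.coe_pow] at h'
  obtain ⟨β, hβ⟩ := hprinc
  have hβ' : 𝔮.asIdeal ^ h = Ideal.span {β} := hβ
  -- the witness
  refine ⟨(τ • β) ^ (p + 1) * β ^ (p - 1), Algebra.norm ℚ (β : K) ^ 2, {q}, ?_, ?_, ?_, ?_⟩
  · have hβ0 : β ≠ 0 := by
      intro h0
      have : 𝔮.asIdeal ^ h = ⊥ := by rw [hβ', h0, Ideal.span_singleton_eq_bot]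
      exact pow_ne_zero h 𝔮.ne_bot this
    have hβ'0 : τ • β ≠ 0 := by
      intro h0; apply hβ0
      have := congrArg (fun x : 𝓞 K => τ⁻¹ • x) h0
      simpa only [inv_smul_smul, smul_zero] using this
    exact mul_ne_zero (pow_ne_zero _ hβ'0) (pow_ne_zero _ hβ0)
  · exact norm_kummerWitness τ β p hp.one_le
  · exact not_exists_pow_eq_kummerWitness hK.1 τ hτ 𝔮 hne hβ' hp hp3
  · intro ℓ₀ hℓ₀ hℓ₀T hℓ₀P hpE hγ v hqv
    rcases Nat.eq_zero_or_pos E with rfl | hE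
    · rw [pow_zero]; exact one_dvd _
    have hℓ₀q : ℓ₀ ≠ q := fun h' => hℓ₀T (Finset.mem_singleton.mpr h')
    exact pow_dvd_orderOf_primeClass_of_kummerWitness hK hd τ hq 𝔮 hq𝔮 hβ' hℓ₀ hℓ₀q hℓ₀P hp hp3 hE
      hpE hγ v hqv

end Literature.NumberTheory.QuadraticFields.RingClass
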